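import Mathlib

/-!
# Jacobi-carry orientation — F1 calibration addendum (crux stmt-BirchSwinnertonDyer-25138)

Kernel-checked bookkeeping behind the calibrated statement J3′ of the crux idea
`jacobi-carry-orientation` (see `Ideas/jacobi-carry-orientation-calibration.md`):
on the ordinary-corner rows the reducible cuspidal line of an optimal curve with
`v = v_p(Δ_min)` sits (Case A, étale kernel, inertia character `ω^{-a}`, `a = (p-1)v/12`)
in the Teichmüller eigen-exponent `j = (p-1)(12-v)/12`, and the Stickelberger carry
`v_p J(χ_p, ω̃^{-j}) = [j > (p-1)/2]` therefore falls on the UNSTARRED member (`v < 6`)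
of every χ-twin pair, never on the starred one (`v > 6`).  This is the opposite of the
orientation guessed in J3 of the card and is what the F1 jobs measured
(j318716, j318753, j318834, j318838).  BSD is not proved by this; Manin `c = 1` is not
proved by this.
-/

namespace Summit.BirchSwinnertonDyer.BirchSwinnertonDyer.Cruxes.EisensteinAdditiveManinResidual.JacobiCarryOrientation

/-- Case-A eigen-exponent of the reducible cuspidal line: `j = (p-1)(12-v)/12`. -/
def caseAExponent (p v : ℕ) : ℕ := (p - 1) * (12 - v) / 12

/-- Stickelberger carry indicator of `J(χ_p, ω̃^{-j})`: `[ (p-1)/2 < j ]`. -/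
def carries (p j : ℕ) : Bool := decide ((p - 1) / 2 < j)

/-- `p = 5`, ordinary corner `III (v=3) / III* (v=9)`: the unstarred exponent `3` carries,
the starred exponent `1` does not. -/
theorem orientation_p5 :
    caseAExponent 5 3 = 3 ∧ caseAExponent 5 9 = 1 ∧
    carries 5 (caseAExponent 5 3) = true ∧ carries 5 (caseAExponent 5 9) = false := by decide

/-- `p = 7`, ordinary corner `II (v=2) / IV* (v=8)` and `IV (v=4) / II* (v=10)`:
exponents `5 / 2` and `4 / 1`; the unstarred ones (`5`, `4`) carry, the starred ones do not. -/
theorem orientation_p7 :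
    caseAExponent 7 2 = 5 ∧ caseAExponent 7 8 = 2 ∧ caseAExponent 7 4 = 4 ∧ caseAExponent 7 10 = 1 ∧
    carries 7 5 = true ∧ carries 7 4 = true ∧ carries 7 2 = false ∧ carries 7 1 = false := by decide

/-- `p = 13` (row C1-adjacent, every `e ∈ {3,4,6}` is ordinary-admissible since `e ∣ 12`):
`v ∈ {2,3,4}` carry, `v ∈ {8,9,10}` do not. -/
theorem orientation_p13 :
    (∀ v ∈ [2, 3, 4], carries 13 (caseAExponent 13 v) = true) ∧
    (∀ v ∈ [8, 9, 10], carries 13 (caseAExponent 13 v) = false) := by decide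

/-- The twin shift: the χ_p-twist moves the exponent by `(p-1)/2`, and the two Case-A exponents of
a twin pair (`v`, `v+6`) differ by exactly that shift (checked on the rows' primes). -/
theorem twinShift_p5_p7_p13 :
    caseAExponent 5 3 = caseAExponent 5 9 + 2 ∧
    caseAExponent 7 2 = caseAExponent 7 8 + 3 ∧ caseAExponent 7 4 = caseAExponent 7 10 + 3 ∧
    (∀ v ∈ [2, 3, 4], caseAExponent 13 v = caseAExponent 13 (v + 6) + 6) := by decide

end Summit.BirchSwinnertonDyer.BirchSwinnertonDyer.Cruxes.EisensteinAdditiveManinResidual.JacobiCarryOrientation
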